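import Mathlib.RingTheory.Nilpotent.Basic
import Mathlib.RingTheory.TensorProduct.Maps
import Mathlib.Data.Finset.NoncommProd
import Literature.AlgebraicGeometry.Motives.MumfordTateInvariantsTensorBasis
import HarnessLib

/-!
# The derivation action of `End(W)` on `T^{a,b}_K W` (Mumford–Tate invariants, step 2)

For a `K`-vector space `W` and `X ∈ End_K(W)` we define the **derivation (Lie algebra) action**
of `X` on the tensor space `T^{a,b}_K W = W^{⊗a} ⊗ (W^∨)^{⊗b}` (`hodgeTensorSpaceOver K W a b`):

* `piTensorSlot a k : End W →ₐ[K] End (W^{⊗a})`, `X ↦ 1 ⊗ ⋯ ⊗ X ⊗ ⋯ ⊗ 1` (`X` in slot `k`);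
* `piTensorDerivation a X = Σₖ piTensorSlot a k X`, the derivation `X` induces on `W^{⊗a}`;
* `tensorDerivation a b X = (piTensorDerivation a X) ⊗ 1 - 1 ⊗ (piTensorDerivation b X^∨)`,
  the derivation on `T^{a,b}_K W` (the dual `W^∨` carries the contragredient action `-X^∨`).

This is the infinitesimal version of the action `tensorSpaceActOver g = g^{⊗a} ⊗ ((g⁻¹)^∨)^{⊗b}`
of `GL(W)` (Deligne, *Hodge cycles on abelian varieties*, LNM 900, I §3.1): the differential of
the representation of `GL(W)` on `T^{a,b}`, i.e. the action of the Lie algebra `𝔤𝔩(W)` (Borel,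
*Linear Algebraic Groups*, 2nd ed., §3.8–3.9 and §7; here purely as linear algebra). We prove:
the formula on pure tensors (`tensorDerivation_tmul_tprod`), that an endomorphism DIAGONAL in a
basis `e` of `W` (`Y (e σ) = y σ • e σ`) acts diagonally on the tensor basis
`hodgeTensorBasis e a b` with eigenvalue `Σₖ y (β k) - Σₗ y (γ l)`
(`tensorDerivation_hodgeTensorBasis`; the infinitesimal form of Deligne's "`μ(λ)` acts on a
tensor of type `(P,Q)` by `λ^{-P}`", I, proof of 3.4), that commuting endomorphisms act by
commuting operators (`commute_tensorDerivation`) and that nilpotent ones act nilpotently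
(`isNilpotent_tensorDerivation`). The exponential `exp` of the action is treated in
`MumfordTateInvariantsExp.lean`.

## References

* P. Deligne, *Hodge cycles on abelian varieties* (notes by J. S. Milne), LNM 900 (1982), I §3.
* A. Borel, *Linear Algebraic Groups*, 2nd ed., GTM 126 (1991), §3.8–3.9.
-/

noncomputable section

open scoped TensorProduct PiTensorProduct

namespace Literature.AlgebraicGeometry.Motives

universe u v w

variable {K : Type u} [Field K] {W : Type v} [AddCommGroup W] [Module K W]

/-! ### One endomorphism in one slot of a tensor power -/

/-- `X ↦ 1 ⊗ ⋯ ⊗ X ⊗ ⋯ ⊗ 1` (`X` in slot `k` of `W^{⊗a}`) as a `K`-linear map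
`End W → End (W^{⊗a})`: the `k`-th partial map of Mathlib's multilinear
`PiTensorProduct.mapMultilinear` at the identity family. [folklore] -/
def piTensorSlotLinear (a : ℕ) (k : Fin a) : Module.End K W →ₗ[K] Module.End K (⨂[K]^a W) :=
  (PiTensorProduct.mapMultilinear K (fun _ : Fin a => W) (fun _ : Fin a => W)).toLinearMap
    (fun _ => LinearMap.id) k

/-- `piTensorSlotLinear a k X` is `PiTensorProduct.map` of the family `Pi.mulSingle k X`
(`X` in slot `k`, identities elsewhere). [folklore] -/
theorem piTensorSlotLinear_apply (a : ℕ) (k : Fin a) (X : Module.End K W) :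
    piTensorSlotLinear a k X = PiTensorProduct.map (Pi.mulSingle k X) :=
  rfl

/-- **Slot embedding** `End W →ₐ[K] End (W^{⊗a})`, `X ↦ 1 ⊗ ⋯ ⊗ X ⊗ ⋯ ⊗ 1` (`X` in slot `k`):
an algebra homomorphism (`PiTensorProduct.map` is a monoid homomorphism and `Pi.mulSingle k` is
multiplicative). [folklore] -/
def piTensorSlot (a : ℕ) (k : Fin a) : Module.End K W →ₐ[K] Module.End K (⨂[K]^a W) :=
  AlgHom.ofLinearMap (piTensorSlotLinear a k)
    (by rw [piTensorSlotLinear_apply, Pi.mulSingle_one]; exact PiTensorProduct.map_one)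
    (fun X Y => by
      rw [piTensorSlotLinear_apply, piTensorSlotLinear_apply, piTensorSlotLinear_apply,
        Pi.mulSingle_mul]
      exact PiTensorProduct.map_mul _ _)

/-- `piTensorSlot a k X = PiTensorProduct.map (Pi.mulSingle k X)`. [folklore] -/
theorem piTensorSlot_apply (a : ℕ) (k : Fin a) (X : Module.End K W) :
    piTensorSlot a k X = PiTensorProduct.map (Pi.mulSingle k X) :=
  rfl

/-- `piTensorSlot` is the monoid homomorphism `PiTensorProduct.mapMonoidHom ∘ mulSingle k`.
[folklore] -/
theorem piTensorSlot_eq_mapMonoidHom (a : ℕ) (k : Fin a) (X : Module.End K W) :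
    piTensorSlot a k X =
      PiTensorProduct.mapMonoidHom (R := K) (s := fun _ : Fin a => W)
        (MonoidHom.mulSingle (fun _ : Fin a => Module.End K W) k X) :=
  rfl

/-- The slot embedding on pure tensors: `X` is applied to the `k`-th factor. [folklore] -/
theorem piTensorSlot_tprod (a : ℕ) (k : Fin a) (X : Module.End K W) (v : Fin a → W) :
    piTensorSlot a k X (PiTensorProduct.tprod K v) =
      PiTensorProduct.tprod K (Function.update v k (X (v k))) := by
  rw [piTensorSlot_apply, PiTensorProduct.map_tprod]
  congr 1
  ext j
  by_cases h : j = k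
  · subst h
    simp
  · simp [Pi.mulSingle, h]

/-- Endomorphisms placed in different slots commute. [folklore] -/
theorem commute_piTensorSlot (a : ℕ) {k l : Fin a} (hkl : k ≠ l) (X Y : Module.End K W) :
    Commute (piTensorSlot a k X) (piTensorSlot a l Y) := by
  rw [piTensorSlot_eq_mapMonoidHom, piTensorSlot_eq_mapMonoidHom]
  exact (Pi.mulSingle_commute (f := fun _ : Fin a => Module.End K W) hkl X Y).map _

/-- The (non-commutative, but pairwise commuting) product over all slots of `g` in slot `k` is
`g^{⊗a} = PiTensorProduct.map (fun _ ↦ g)`. [folklore] -/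
theorem noncommProd_piTensorSlot (a : ℕ) (g : Module.End K W) :
    (Finset.univ.noncommProd (fun k => piTensorSlot a k g) fun _ _ _ _ hkl =>
        commute_piTensorSlot a hkl g g) =
      PiTensorProduct.map fun _ : Fin a => g := by
  have h := Finset.noncommProd_mulSingle (M := fun _ : Fin a => Module.End K W) fun _ => g
  have h2 := Finset.map_noncommProd Finset.univ
    (fun k => Pi.mulSingle (M := fun _ : Fin a => Module.End K W) k g)
    (fun i _ j _ _ => Pi.mulSingle_apply_commute (fun _ => g) i j)
    (PiTensorProduct.mapMonoidHom (R := K) (s := fun _ : Fin a => W))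
  rw [h] at h2
  rw [PiTensorProduct.mapMonoidHom_apply] at h2
  rw [h2]
  rfl

/-! ### The derivation on a tensor power -/

/-- The derivation `X ↦ Σₖ (1 ⊗ ⋯ ⊗ X ⊗ ⋯ ⊗ 1)` induced by `X ∈ End W` on `W^{⊗a}` (the action of
the Lie algebra `𝔤𝔩(W)` on the tensor power), `K`-linear in `X`. [folklore] -/
def piTensorDerivation (a : ℕ) : Module.End K W →ₗ[K] Module.End K (⨂[K]^a W) :=
  ∑ k : Fin a, (piTensorSlot a k).toLinearMap

/-- `piTensorDerivation a X = Σₖ piTensorSlot a k X`. [folklore] -/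
theorem piTensorDerivation_apply (a : ℕ) (X : Module.End K W) :
    piTensorDerivation a X = ∑ k : Fin a, piTensorSlot a k X := by
  simp [piTensorDerivation]

/-- The derivation on pure tensors: `X · (⊗ vₖ) = Σₖ v₁ ⊗ ⋯ ⊗ X vₖ ⊗ ⋯ ⊗ vₐ`. [folklore] -/
theorem piTensorDerivation_tprod (a : ℕ) (X : Module.End K W) (v : Fin a → W) :
    piTensorDerivation a X (PiTensorProduct.tprod K v) =
      ∑ k : Fin a, PiTensorProduct.tprod K (Function.update v k (X (v k))) := by
  simp [piTensorDerivation_apply, piTensorSlot_tprod]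

/-- Commuting endomorphisms induce commuting derivations of the tensor power. [folklore] -/
theorem commute_piTensorDerivation (a : ℕ) {X Y : Module.End K W} (h : Commute X Y) :
    Commute (piTensorDerivation a X) (piTensorDerivation a Y) := by
  rw [piTensorDerivation_apply, piTensorDerivation_apply]
  refine Commute.sum_left _ _ _ fun k _ => Commute.sum_right _ _ _ fun l _ => ?_
  by_cases hkl : k = l
  · subst hkl
    exact h.map (piTensorSlot a k)
  · exact commute_piTensorSlot a hkl X Y

/-- A nilpotent endomorphism induces a nilpotent derivation of the tensor power (a sum of
pairwise commuting nilpotents). [folklore] -/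
theorem isNilpotent_piTensorDerivation (a : ℕ) {N : Module.End K W} (hN : IsNilpotent N) :
    IsNilpotent (piTensorDerivation a N) := by
  rw [piTensorDerivation_apply]
  refine Commute.isNilpotent_sum (fun k _ => hN.map (piTensorSlot a k)) fun k l _ _ => ?_
  by_cases hkl : k = l
  · subst hkl
    exact Commute.refl _
  · exact commute_piTensorSlot a hkl N N

/-! ### The derivation on `T^{a,b}_K W` -/

/-- Powers commute with taking the dual map (transpose): `(Xᵏ)^∨ = (X^∨)ᵏ`. [folklore] -/
theorem dualMap_pow (X : Module.End K W) (k : ℕ) :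
    (X ^ k).dualMap = (X.dualMap : Module.End K (Module.Dual K W)) ^ k := by
  induction k with
  | zero => rfl
  | succ k ih =>
    rw [pow_succ, pow_succ', Module.End.mul_eq_comp, ← LinearMap.dualMap_comp_dualMap, ih]
    rfl

/-- Commuting endomorphisms have commuting transposes. [folklore] -/
theorem commute_dualMap {X Y : Module.End K W} (h : Commute X Y) :
    Commute (X.dualMap : Module.End K (Module.Dual K W)) Y.dualMap := by
  change X.dualMap ∘ₗ Y.dualMap = Y.dualMap ∘ₗ X.dualMap
  rw [LinearMap.dualMap_comp_dualMap, LinearMap.dualMap_comp_dualMap]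
  exact congrArg LinearMap.dualMap h.symm.eq

/-- The transpose of a nilpotent endomorphism is nilpotent. [folklore] -/
theorem isNilpotent_dualMap {N : Module.End K W} (hN : IsNilpotent N) :
    IsNilpotent (N.dualMap : Module.End K (Module.Dual K W)) := by
  obtain ⟨k, hk⟩ := hN
  exact ⟨k, by rw [← dualMap_pow, hk]; exact map_zero (Module.Dual.transpose (R := K))⟩

/-- The **derivation action** of `X ∈ End_K(W)` on `T^{a,b}_K W = W^{⊗a} ⊗ (W^∨)^{⊗b}`:
`X` acts as a derivation on the `a` covariant factors and as `-X^∨` on the `b` contravariant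
factors (the differential of `g ↦ g^{⊗a} ⊗ ((g⁻¹)^∨)^{⊗b}`, Deligne, LNM 900, I §3.1; Borel,
*Linear Algebraic Groups*, §3.9). `K`-linear in `X`. [folklore] -/
def tensorDerivation (a b : ℕ) :
    Module.End K W →ₗ[K] Module.End K (hodgeTensorSpaceOver K W a b) where
  toFun X := LinearMap.rTensor (⨂[K]^b (Module.Dual K W)) (piTensorDerivation a X) -
    LinearMap.lTensor (⨂[K]^a W) (piTensorDerivation b (LinearMap.dualMap X))
  map_add' X Y := by
    rw [map_add, LinearMap.dualMap_def, map_add, map_add, LinearMap.rTensor_add,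
      LinearMap.lTensor_add]
    simp only [← LinearMap.dualMap_def]
    abel
  map_smul' c X := by
    rw [map_smul, LinearMap.dualMap_def, map_smul, map_smul, LinearMap.rTensor_smul,
      LinearMap.lTensor_smul, RingHom.id_apply]
    exact (smul_sub c (LinearMap.rTensor (⨂[K]^b (Module.Dual K W)) (piTensorDerivation a X))
      (LinearMap.lTensor (⨂[K]^a W) (piTensorDerivation b (LinearMap.dualMap X)))).symm

/-- Unfolding of the derivation action: `ρ(X) = D_a(X) ⊗ 1 - 1 ⊗ D_b(X^∨)`. [folklore] -/
theorem tensorDerivation_apply (a b : ℕ) (X : Module.End K W) :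
    tensorDerivation a b X =
      LinearMap.rTensor (⨂[K]^b (Module.Dual K W)) (piTensorDerivation a X) -
        LinearMap.lTensor (⨂[K]^a W) (piTensorDerivation b (LinearMap.dualMap X)) :=
  rfl

/-- `Module.End.rTensorAlgHom` is `LinearMap.rTensor` (unfolding). [folklore] -/
theorem rTensorAlgHom_apply' {M : Type*} {N : Type*} [AddCommGroup M] [Module K M]
    [AddCommGroup N] [Module K N] (f : Module.End K M) :
    Module.End.rTensorAlgHom K M N f = f.rTensor N :=
  rfl

/-- `Module.End.lTensorAlgHom` is `LinearMap.lTensor` (unfolding). [folklore] -/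
theorem lTensorAlgHom_apply' {M : Type*} {N : Type*} [AddCommGroup M] [Module K M]
    [AddCommGroup N] [Module K N] (f : Module.End K M) :
    Module.End.lTensorAlgHom K M N f = f.lTensor N :=
  rfl

/-- The derivation action on pure tensors:
`ρ(X) ((⊗ vₖ) ⊗ (⊗ φₗ)) = (Σₖ ⋯ ⊗ X vₖ ⊗ ⋯) ⊗ (⊗ φₗ) - (⊗ vₖ) ⊗ (Σₗ ⋯ ⊗ φₗ ∘ X ⊗ ⋯)`. [folklore] -/
theorem tensorDerivation_tmul_tprod (a b : ℕ) (X : Module.End K W) (v : Fin a → W)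
    (φ : Fin b → Module.Dual K W) :
    tensorDerivation a b X (PiTensorProduct.tprod K v ⊗ₜ[K] PiTensorProduct.tprod K φ) =
      (∑ k : Fin a, PiTensorProduct.tprod K (Function.update v k (X (v k)))) ⊗ₜ[K]
          PiTensorProduct.tprod K φ -
        PiTensorProduct.tprod K v ⊗ₜ[K]
          ∑ l : Fin b, PiTensorProduct.tprod K (Function.update φ l ((φ l).comp X)) := by
  rw [tensorDerivation_apply, LinearMap.sub_apply, LinearMap.rTensor_tmul, LinearMap.lTensor_tmul,
    piTensorDerivation_tprod, piTensorDerivation_tprod]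
  rfl

/-- Commuting endomorphisms act on `T^{a,b}_K W` by commuting operators. [folklore] -/
theorem commute_tensorDerivation (a b : ℕ) {X Y : Module.End K W} (h : Commute X Y) :
    Commute (tensorDerivation a b X) (tensorDerivation a b Y) := by
  rw [tensorDerivation_apply, tensorDerivation_apply]
  have hA := (commute_piTensorDerivation a h).map
    (Module.End.rTensorAlgHom K (⨂[K]^a W) (⨂[K]^b (Module.Dual K W)))
  have hB := (commute_piTensorDerivation b (commute_dualMap h)).map
    (Module.End.lTensorAlgHom K (⨂[K]^b (Module.Dual K W)) (⨂[K]^a W))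
  change Commute (LinearMap.rTensor _ (piTensorDerivation a X))
    (LinearMap.rTensor _ (piTensorDerivation a Y)) at hA
  change Commute (LinearMap.lTensor _ (piTensorDerivation b (LinearMap.dualMap X)))
    (LinearMap.lTensor _ (piTensorDerivation b (LinearMap.dualMap Y))) at hB
  have hcross : ∀ (f : Module.End K (⨂[K]^a W)) (g : Module.End K (⨂[K]^b (Module.Dual K W))),
      Commute (f.rTensor (⨂[K]^b (Module.Dual K W))) (g.lTensor (⨂[K]^a W)) := fun f g => by
    change f.rTensor _ ∘ₗ g.lTensor _ = g.lTensor _ ∘ₗ f.rTensor _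
    rw [LinearMap.rTensor_comp_lTensor, LinearMap.lTensor_comp_rTensor]
  exact Commute.sub_left (R := Module.End K (hodgeTensorSpaceOver K W a b))
    (Commute.sub_right (R := Module.End K (hodgeTensorSpaceOver K W a b)) hA
      (hcross (piTensorDerivation a X) (piTensorDerivation b Y.dualMap)))
    (Commute.sub_right (R := Module.End K (hodgeTensorSpaceOver K W a b))
      (hcross (piTensorDerivation a Y) (piTensorDerivation b X.dualMap)).symm hB)

/-- A nilpotent endomorphism acts nilpotently on `T^{a,b}_K W`. [folklore] -/
theorem isNilpotent_tensorDerivation (a b : ℕ) {N : Module.End K W} (hN : IsNilpotent N) :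
    IsNilpotent (tensorDerivation a b N) := by
  rw [tensorDerivation_apply]
  have hA := (isNilpotent_piTensorDerivation a hN).map
    (Module.End.rTensorAlgHom K (⨂[K]^a W) (⨂[K]^b (Module.Dual K W)))
  have hB := (isNilpotent_piTensorDerivation b (isNilpotent_dualMap hN)).map
    (Module.End.lTensorAlgHom K (⨂[K]^b (Module.Dual K W)) (⨂[K]^a W))
  change IsNilpotent (LinearMap.rTensor _ (piTensorDerivation a N)) at hA
  change IsNilpotent (LinearMap.lTensor _ (piTensorDerivation b (LinearMap.dualMap N))) at hB
  have hcomm : Commute (LinearMap.rTensor (⨂[K]^b (Module.Dual K W)) (piTensorDerivation a N))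
      (LinearMap.lTensor (⨂[K]^a W) (piTensorDerivation b N.dualMap)) := by
    change _ ∘ₗ _ = _ ∘ₗ _
    rw [LinearMap.rTensor_comp_lTensor, LinearMap.lTensor_comp_rTensor]
  exact Commute.isNilpotent_sub (R := Module.End K (hodgeTensorSpaceOver K W a b)) hcomm hA hB

/-! ### Diagonal endomorphisms act diagonally on the tensor basis -/

section Diagonal

variable {S : Type w} [Fintype S] [DecidableEq S]

/-- A dual-basis vector precomposed with an endomorphism diagonal in the basis is scaled by the
eigenvalue: `e^∨_τ ∘ Y = y τ • e^∨_τ`. [folklore] -/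
theorem dualBasis_comp_of_diag (e : Module.Basis S K W) {Y : Module.End K W} {y : S → K}
    (hY : ∀ σ, Y (e σ) = y σ • e σ) (τ : S) :
    (e.dualBasis τ).comp Y = y τ • e.dualBasis τ := by
  refine e.ext fun σ => ?_
  by_cases h : σ = τ
  · subst h
    simp [hY]
  · simp [hY, h]

/-- **Diagonal endomorphisms act diagonally on the tensor basis.** If `Y (e σ) = y σ • e σ` for
all `σ`, then the derivation action of `Y` on `(⊗ₖ e (β k)) ⊗ (⊗ₗ e^∨ (γ l))` is multiplication
by `Σₖ y (β k) - Σₗ y (γ l)` (the infinitesimal form of Deligne, LNM 900, I, proof of 3.4).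
[cite: Deligne1982HodgeCycles, I proof of Prop. 3.4] -/
theorem tensorDerivation_hodgeTensorBasis (e : Module.Basis S K W) {a b : ℕ} {Y : Module.End K W}
    {y : S → K} (hY : ∀ σ, Y (e σ) = y σ • e σ) (β : Fin a → S) (γ : Fin b → S) :
    tensorDerivation a b Y (hodgeTensorBasis e a b (β, γ)) =
      ((∑ k, y (β k)) - ∑ l, y (γ l)) • hodgeTensorBasis e a b (β, γ) := by
  rw [hodgeTensorBasis_apply, tensorDerivation_tmul_tprod]
  have h₁ : ∀ k : Fin a, PiTensorProduct.tprod K (Function.update (fun k => e (β k)) k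
      (Y (e (β k)))) = y (β k) • PiTensorProduct.tprod K fun k => e (β k) := by
    intro k
    rw [hY, MultilinearMap.map_update_smul, Function.update_eq_self]
  have h₂ : ∀ l : Fin b, PiTensorProduct.tprod K (Function.update (fun l => e.dualBasis (γ l)) l
      ((e.dualBasis (γ l)).comp Y)) = y (γ l) • PiTensorProduct.tprod K fun l => e.dualBasis (γ l) := by
    intro l
    rw [dualBasis_comp_of_diag e hY, MultilinearMap.map_update_smul, Function.update_eq_self]
  simp_rw [h₁, h₂]
  rw [← Finset.sum_smul, ← Finset.sum_smul, ← TensorProduct.smul_tmul', TensorProduct.tmul_smul]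
  exact (sub_smul (∑ k, y (β k)) (∑ l, y (γ l))
    ((PiTensorProduct.tprod K fun k => e (β k)) ⊗ₜ[K]
      PiTensorProduct.tprod K fun l => e.dualBasis (γ l))).symm

/-- The diagonal action restated for an index pair `x`. [folklore] -/
theorem tensorDerivation_hodgeTensorBasis' (e : Module.Basis S K W) {a b : ℕ} {Y : Module.End K W}
    {y : S → K} (hY : ∀ σ, Y (e σ) = y σ • e σ) (x : (Fin a → S) × (Fin b → S)) :
    tensorDerivation a b Y (hodgeTensorBasis e a b x) =
      ((∑ k, y (x.1 k)) - ∑ l, y (x.2 l)) • hodgeTensorBasis e a b x :=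
  tensorDerivation_hodgeTensorBasis e hY x.1 x.2

end Diagonal

end Literature.AlgebraicGeometry.Motives

end
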